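import Literature.Computability.QuantumComplexity.JonesLocalGate
import Literature.Computability.QuantumComplexity.SandwichApprox
import Literature.Computability.QuantumComplexity.DyadicThresholds
import HarnessLib

/-!
# The AJL local core gate as two controlled rotations and a controlled phase

Topic `Literature/Computability/QuantumComplexity`; a step in the discharge of
`ajl_jonesApproxProblem_mem_PromiseBQP`. The phase-free core `ajlLocalCore ± = 1 + (c_± − 1)P`
(`JonesLocalGate.lean`; `P = Σ_z |φ_z⟩⟨φ_z|` on the three vertex registers `(L | M | R)` = wires
`(0,1 | 2,3 | 4,5)`, `c_± = e^{±3πi/5}`) is factored as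

  `ajlLocalCore ± = 𝔉 · D(c_±) · 𝔉ᴴ`,   `𝔉 = rot₂ · rot₃`,

where `rot₂` rotates the high middle bit (wire `2`) by the real rotation
`G₂ = [[a₂, −b₂], [b₂, a₂]]`, `a₂ = √λ₁/√(dλ₂) = 1/φ`, `b₂ = √λ₃/√(dλ₂) = 1/√φ`, on the labels with
`L = R = 2` and low middle bit `0`; `rot₃` rotates wire `2` by `G₃ = [[a₃, −b₃], [b₃, a₃]]`,
`a₃ = 1/√φ`, `b₃ = 1/φ`, on the labels with `L = R = 3` and low middle bit `1`; and `D(c)` is the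
diagonal phase `c` on the four reference labels `ε_z = (z, e_z, z)`, `e₁ = e₃ = 2`, `e₂ = 1`, `e₄ = 3`
(`𝔉 ε_z = φ_z`). Both rotations are `ctrlGate`s of `SandwichApprox.lean` (blocks read off the label,
independent of the rotated bit), so each factor is a target of the Hadamard-sandwich gadgets; the
entries `1/φ`, `1/√φ` are those of `DyadicThresholds.lean`.

## References

* D. Aharonov, V. Jones, Z. Landau, Algorithmica 55 (2009) = arXiv:quant-ph/0511096, Claim 2.6,
  §2.12, Claim 4.1 (applying the local unitaries) [AharonovJonesLandau2009].
-/

noncomputable section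

namespace Literature.Computability.QuantumComplexity

open _root_.Matrix Complex Finset Cryptography

/-! ### `ctrlGate` on basis states -/

section CtrlGate

variable {N : ℕ}

/-- A label-controlled one-qubit gate on a basis state. [folklore] -/
theorem ctrlGate_mulVec_basisState (t : Fin N) (U : QReg N → Matrix (QReg 1) (QReg 1) ℂ) (w : QReg N) :
    ctrlGate t U *ᵥ basisState w =
      U w (fun _ => false) (fun _ => w t) • basisState (Function.update w t false) +
        U w (fun _ => true) (fun _ => w t) • basisState (Function.update w t true) := by
  ext x
  rw [mulVec_basisState]
  dsimp only
  rw [ctrlGate_apply]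
  simp only [Pi.add_apply, Pi.smul_apply, basisState, Pi.single_apply, smul_eq_mul, mul_ite, mul_one, mul_zero]
  have hne : ∀ b : Bool, Function.update w t b ≠ Function.update w t (!b) := fun b e => by
    have := congrFun e t; simp at this
  by_cases h : EqOff [t] w x
  · rw [if_pos h]
    have hx : x = Function.update w t (x t) := by rw [eqOff_singleton_iff.1 h]; simp
    cases hxt : x t
    · rw [hxt] at hx
      rw [if_pos hx, if_neg (by rw [hx]; exact hne false), add_zero]
    · rw [hxt] at hx
      rw [if_neg (by rw [hx]; exact hne true), if_pos hx, zero_add]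
  · rw [if_neg h, if_neg, if_neg, add_zero]
    · intro e; apply h; rw [e]; exact eqOff_singleton_iff.2 (by simp)
    · intro e; apply h; rw [e]; exact eqOff_singleton_iff.2 (by simp)

/-- With the identity block, `ctrlGate` fixes the basis state. [folklore] -/
theorem ctrlGate_mulVec_basisState_of_one (t : Fin N) (U : QReg N → Matrix (QReg 1) (QReg 1) ℂ) (w : QReg N)
    (hU : U w = 1) : ctrlGate t U *ᵥ basisState w = basisState w := by
  rw [ctrlGate_mulVec_basisState, hU]
  cases hw : w t
  · rw [Matrix.one_apply_eq, Matrix.one_apply_ne (by intro e; have := congrFun e 0; simp at this), one_smul, zero_smul, add_zero,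
      ← hw, Function.update_eq_self]
  · rw [Matrix.one_apply_ne (by intro e; have := congrFun e 0; simp at this), Matrix.one_apply_eq, zero_smul, one_smul, zero_add,
      ← hw, Function.update_eq_self]

end CtrlGate

/-! ### Conjugating a rank-one projection -/

section Algebra

variable {N : ℕ}

/-- The orthogonal projection onto a vector, `|v⟩⟨v|`. [folklore] -/
def projVec (v : QReg N → ℂ) : Matrix (QReg N) (QReg N) ℂ := Matrix.vecMulVec v (star v)

/-- **Conjugation moves the projection**: `F |v⟩⟨v| Fᴴ = |Fv⟩⟨Fv|`. [folklore] -/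
theorem mul_projVec_mul_conjTranspose (F : Matrix (QReg N) (QReg N) ℂ) (v : QReg N → ℂ) :
    F * projVec v * Fᴴ = projVec (F *ᵥ v) := by
  ext i j
  simp only [projVec, Matrix.mul_apply, Matrix.vecMulVec_apply, Matrix.conjTranspose_apply, Matrix.mulVec, dotProduct,
    Pi.star_apply, star_sum, star_mul', Finset.sum_mul, Finset.mul_sum]
  refine Finset.sum_congr rfl fun a _ => Finset.sum_congr rfl fun b _ => ?_
  ring

end Algebra

/-! ### Sums over one-qubit labels -/

/-- A sum over `QReg 1` has two terms. [folklore] -/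
theorem sum_qReg_one_bool {M : Type*} [AddCommMonoid M] (f : QReg 1 → M) : ∑ v, f v = f (fun _ => false) + f (fun _ => true) := by
  rw [← Finset.sum_subset (Finset.subset_univ {(fun _ => false : QReg 1), fun _ => true})
    (fun v _ hv => by exfalso; apply hv; rw [qreg_one_eq v]; cases v 0 <;> simp)]
  rw [Finset.sum_pair (by intro h; have := congrFun h 0; simp at this)]

/-! ### Real rotations of one qubit -/

/-- The real `2 × 2` matrix `[[a, −b], [b, a]]` (first column `(a, b)`). [folklore] -/
def rot2x2 (a b : ℝ) : Matrix (QReg 1) (QReg 1) ℂ :=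
  Matrix.of fun x y => if x 0 = false then (if y 0 = false then (a : ℂ) else -(b : ℂ)) else (if y 0 = false then (b : ℂ) else (a : ℂ))

/-- Entries of `rot2x2`. [folklore] -/
theorem rot2x2_apply (a b : ℝ) (x y : QReg 1) :
    rot2x2 a b x y = if x 0 = false then (if y 0 = false then (a : ℂ) else -(b : ℂ)) else (if y 0 = false then (b : ℂ) else (a : ℂ)) := rfl

/-- `[[a, −b], [b, a]]` is unitary when `a² + b² = 1`. [folklore] -/
theorem rot2x2_mem_unitaryGroup {a b : ℝ} (h : a ^ 2 + b ^ 2 = 1) : rot2x2 a b ∈ Matrix.unitaryGroup (QReg 1) ℂ := by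
  rw [Matrix.mem_unitaryGroup_iff]
  ext x y
  rw [Matrix.mul_apply, sum_qReg_one_bool, Matrix.one_apply]
  simp only [Matrix.star_apply, rot2x2_apply]
  have hc : (a : ℂ) ^ 2 + (b : ℂ) ^ 2 = 1 := by exact_mod_cast h
  have hne : (fun _ => false : QReg 1) ≠ fun _ => true := by intro e; have := congrFun e 0; simp at this
  rw [qreg_one_eq x, qreg_one_eq y]
  cases x 0 <;> cases y 0 <;> simp [hne, hne.symm] <;> first | linear_combination hc | ring

/-! ### The pieces of the decomposition -/

/-- The vertex read on the left register. [cite: AharonovJonesLandau2009, §2.12] -/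
abbrev vL (p : QReg 6) : ℤ := vertexOfBits (p 0) (p 1)
/-- The vertex read on the middle register. [cite: AharonovJonesLandau2009, §2.12] -/
abbrev vM (p : QReg 6) : ℤ := vertexOfBits (p 2) (p 3)
/-- The vertex read on the right register. [cite: AharonovJonesLandau2009, §2.12] -/
abbrev vR (p : QReg 6) : ℤ := vertexOfBits (p 4) (p 5)

/-- The amplitude of `|z − 1⟩` in `u_z`: `√λ_{z−1}/√(dλ_z)`. [cite: AharonovJonesLandau2009, Claim 2.6] -/
def rotAmpA (z : ℤ) : ℝ := Real.sqrt (ajlWeight 5 (z - 1)) / Real.sqrt (ajlLoopValue 5 * ajlWeight 5 z)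
/-- The amplitude of `|z + 1⟩` in `u_z`: `√λ_{z+1}/√(dλ_z)`. [cite: AharonovJonesLandau2009, Claim 2.6] -/
def rotAmpB (z : ℤ) : ℝ := Real.sqrt (ajlWeight 5 (z + 1)) / Real.sqrt (ajlLoopValue 5 * ajlWeight 5 z)

/-- `a_z² + b_z² = 1` (`λ_{z−1} + λ_{z+1} = dλ_z`, Claim 2.6). [cite: AharonovJonesLandau2009, Claim 2.6] -/
theorem rotAmp_sq_add_sq {z : ℤ} (hz : 1 ≤ z ∧ z ≤ 4) : rotAmpA z ^ 2 + rotAmpB z ^ 2 = 1 := by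
  have hd : 0 < ajlLoopValue 5 * ajlWeight 5 z := ajlLoopValue_mul_ajlWeight_pos hz
  rw [rotAmpA, rotAmpB, div_pow, div_pow, Real.sq_sqrt (ajlWeight_nonneg _ _), Real.sq_sqrt (ajlWeight_nonneg _ _),
    Real.sq_sqrt hd.le, ← add_div, ajlWeight_pred_add_succ ⟨hz.1, by omega⟩, div_self hd.ne']

/-- The condition of the first rotation: `L = R = 2` and low middle bit `0`. [cite: AharonovJonesLandau2009, Claim 4.1] -/
def Cond₂ (w : QReg 6) : Prop := vL w = 2 ∧ vR w = 2 ∧ w 3 = false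
/-- The condition of the second rotation: `L = R = 3` and low middle bit `1`. [cite: AharonovJonesLandau2009, Claim 4.1] -/
def Cond₃ (w : QReg 6) : Prop := vL w = 3 ∧ vR w = 3 ∧ w 3 = true

/-- `Cond₂` is decidable. [folklore] -/
instance : DecidablePred Cond₂ := fun _ => by unfold Cond₂; infer_instance
/-- `Cond₃` is decidable. [folklore] -/
instance : DecidablePred Cond₃ := fun _ => by unfold Cond₃; infer_instance

/-- The blocks of the rotations: `G_z` where the condition holds, identity elsewhere. [folklore] -/
def rotBlock (z : ℤ) (cnd : QReg 6 → Prop) [DecidablePred cnd] (w : QReg 6) : Matrix (QReg 1) (QReg 1) ℂ :=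
  if cnd w then rot2x2 (rotAmpA z) (rotAmpB z) else 1

/-- **The first rotation** `rot₂` (wire `2`, block `G₂`, condition `Cond₂`). [cite: AharonovJonesLandau2009, Claim 4.1] -/
def ajlRot2 : Matrix (QReg 6) (QReg 6) ℂ := ctrlGate 2 (rotBlock 2 Cond₂)
/-- **The second rotation** `rot₃` (wire `2`, block `G₃`, condition `Cond₃`). [cite: AharonovJonesLandau2009, Claim 4.1] -/
def ajlRot3 : Matrix (QReg 6) (QReg 6) ℂ := ctrlGate 2 (rotBlock 3 Cond₃)
/-- `𝔉 = rot₂ · rot₃`. [cite: AharonovJonesLandau2009, Claim 4.1] -/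
def ajlF : Matrix (QReg 6) (QReg 6) ℂ := ajlRot2 * ajlRot3

/-- The middle reference vertex `e_z`: `e₁ = e₃ = 2`, `e₂ = 1`, `e₄ = 3`. [folklore] -/
def eRef (z : ℤ) : ℤ := if z = 2 then 1 else if z = 4 then 3 else 2

/-- The reference labels carry the phase: `L = R` and `M = e_L`. [folklore] -/
def ECond (w : QReg 6) : Prop := vL w = vR w ∧ vM w = eRef (vL w)

/-- `ECond` is decidable. [folklore] -/
instance : DecidablePred ECond := fun _ => by unfold ECond eRef; infer_instance

/-- **The controlled phase** `D(c)`: `c` on the reference labels, `1` elsewhere. [cite: AharonovJonesLandau2009, Claim 4.1] -/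
def ajlPhaseDiag (c : ℂ) : Matrix (QReg 6) (QReg 6) ℂ := Matrix.diagonal fun w => if ECond w then c else 1

/-! ### Unitarity of the rotations -/

/-- The blocks are unitary. [folklore] -/
theorem rotBlock_mem_unitaryGroup {z : ℤ} (hz : 1 ≤ z ∧ z ≤ 4) (cnd : QReg 6 → Prop) [DecidablePred cnd] (w : QReg 6) :
    rotBlock z cnd w ∈ Matrix.unitaryGroup (QReg 1) ℂ := by
  unfold rotBlock; split_ifs
  · exact rot2x2_mem_unitaryGroup (rotAmp_sq_add_sq hz)
  · exact Submonoid.one_mem _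

/-- The conditions do not read the rotated bit. [folklore] -/
theorem cond₂_update (w : QReg 6) (b : Bool) : Cond₂ (Function.update w 2 b) ↔ Cond₂ w := by
  simp [Cond₂, vL, vR, Function.update_of_ne]

/-- The conditions do not read the rotated bit. [folklore] -/
theorem cond₃_update (w : QReg 6) (b : Bool) : Cond₃ (Function.update w 2 b) ↔ Cond₃ w := by
  simp [Cond₃, vL, vR, Function.update_of_ne]

/-- `rot₂` is unitary. [folklore] -/
theorem ajlRot2_mem_unitaryGroup : ajlRot2 ∈ Matrix.unitaryGroup (QReg 6) ℂ :=
  ctrlGate_mem_unitaryGroup 2 (fun w => rotBlock_mem_unitaryGroup (by norm_num) _ w) fun w b => by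
    unfold rotBlock; exact if_congr (cond₂_update w b) rfl rfl

/-- `rot₃` is unitary. [folklore] -/
theorem ajlRot3_mem_unitaryGroup : ajlRot3 ∈ Matrix.unitaryGroup (QReg 6) ℂ :=
  ctrlGate_mem_unitaryGroup 2 (fun w => rotBlock_mem_unitaryGroup (by norm_num) _ w) fun w b => by
    unfold rotBlock; exact if_congr (cond₃_update w b) rfl rfl

/-- `𝔉` is unitary. [folklore] -/
theorem ajlF_mem_unitaryGroup : ajlF ∈ Matrix.unitaryGroup (QReg 6) ℂ :=
  Submonoid.mul_mem _ ajlRot2_mem_unitaryGroup ajlRot3_mem_unitaryGroup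

/-! ### The reference labels and the action of `𝔉` on them -/

/-- The label reading `(l₀l₁ | m₀m₁ | r₀r₁)`. [folklore] -/
def lab (l₀ l₁ m₀ m₁ r₀ r₁ : Bool) : QReg 6 := ![l₀, l₁, m₀, m₁, r₀, r₁]

/-- `ε₁ = (1, 2, 1)`. [folklore] -/
def eps1 : QReg 6 := lab false false false true false false
/-- `ε₂ = (2, 1, 2)`. [folklore] -/
def eps2 : QReg 6 := lab false true false false false true
/-- `ε₂' = (2, 3, 2)`. [folklore] -/
def eps2' : QReg 6 := lab false true true false false true
/-- `ε₃ = (3, 2, 3)`. [folklore] -/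
def eps3 : QReg 6 := lab true false false true true false
/-- `ε₃' = (3, 4, 3)`. [folklore] -/
def eps3' : QReg 6 := lab true false true true true false
/-- `ε₄ = (4, 3, 4)`. [folklore] -/
def eps4 : QReg 6 := lab true true true false true true

/-- The complex vector `φ_z`. [cite: AharonovJonesLandau2009, Claim 2.6] -/
def vecC (z : ℤ) : QReg 6 → ℂ := fun q => (ajlLocalVec z q : ℂ)

/-- The supports of the `φ_z` and of the phase, as finite label facts. [folklore] -/
theorem support_facts :
    (∀ q : QReg 6, (vL q = 1 ∧ vR q = 1 ∧ (vM q = 1 + 1 ∨ vM q = 1 - 1)) ↔ q = eps1) ∧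
    (∀ q : QReg 6, (vL q = 2 ∧ vR q = 2 ∧ (vM q = 2 + 1 ∨ vM q = 2 - 1)) ↔ (q = eps2 ∨ q = eps2')) ∧
    (∀ q : QReg 6, (vL q = 3 ∧ vR q = 3 ∧ (vM q = 3 + 1 ∨ vM q = 3 - 1)) ↔ (q = eps3 ∨ q = eps3')) ∧
    (∀ q : QReg 6, (vL q = 4 ∧ vR q = 4 ∧ (vM q = 4 + 1 ∨ vM q = 4 - 1)) ↔ q = eps4) ∧
    (∀ q : QReg 6, ECond q ↔ (q = eps1 ∨ q = eps2 ∨ q = eps3 ∨ q = eps4)) := by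
  unfold ECond eRef vL vM vR vertexOfBits eps1 eps2 eps2' eps3 eps3' eps4 lab
  refine ⟨?_, ?_, ?_, ?_, ?_⟩ <;> decide

/-- `ajlLocalVec` unfolded with the register readings. [folklore] -/
theorem ajlLocalVec_eq (z : ℤ) (q : QReg 6) :
    ajlLocalVec z q = if vL q = z ∧ vR q = z ∧ (vM q = z + 1 ∨ vM q = z - 1) then
      Real.sqrt (ajlWeight 5 (vM q)) / Real.sqrt (ajlLoopValue 5 * ajlWeight 5 z) else 0 := rfl

/-- `dλ₁ = λ₂` and `dλ₄ = λ₃` (the end-vertex cases of Claim 2.6), as amplitude `1`. [cite: AharonovJonesLandau2009, Claim 2.6] -/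
theorem endAmp_eq_one :
    Real.sqrt (ajlWeight 5 2) / Real.sqrt (ajlLoopValue 5 * ajlWeight 5 1) = 1 ∧
      Real.sqrt (ajlWeight 5 3) / Real.sqrt (ajlLoopValue 5 * ajlWeight 5 4) = 1 := by
  have h1 := ajlWeight_pred_add_succ (k := 5) (z := 1) ⟨le_rfl, by norm_num⟩
  have h4 := ajlWeight_pred_add_succ (k := 5) (z := 4) ⟨by norm_num, by norm_num⟩
  rw [ajlWeight_of_not (k := 5) (ℓ := 1 - 1) (by norm_num), zero_add] at h1
  rw [ajlWeight_of_not (k := 5) (ℓ := 4 + 1) (by norm_num), add_zero] at h4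
  norm_num at h1 h4
  constructor
  · rw [← h1, div_self]; exact (Real.sqrt_pos.2 (by rw [h1]; exact ajlLoopValue_mul_ajlWeight_pos ⟨le_rfl, by norm_num⟩)).ne'
  · rw [← h4, div_self]; exact (Real.sqrt_pos.2 (by rw [h4]; exact ajlLoopValue_mul_ajlWeight_pos ⟨by norm_num, le_rfl⟩)).ne'

/-- Register readings of the reference labels. [folklore] -/
theorem readings :
    vM eps1 = 2 ∧ vM eps2 = 1 ∧ vM eps2' = 3 ∧ vM eps3 = 2 ∧ vM eps3' = 4 ∧ vM eps4 = 3 ∧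
    eps2' = Function.update eps2 2 true ∧ eps3' = Function.update eps3 2 true ∧
    eps2 2 = false ∧ eps3 2 = false ∧ Cond₂ eps2 ∧ ¬ Cond₃ eps2 ∧ Cond₃ eps3 ∧ ¬ Cond₂ eps3 ∧ ¬ Cond₂ eps3' ∧
    ¬ Cond₂ eps1 ∧ ¬ Cond₃ eps1 ∧ ¬ Cond₂ eps4 ∧ ¬ Cond₃ eps4 ∧ eps2 ≠ eps2' ∧ eps3 ≠ eps3' := by
  unfold Cond₂ Cond₃ vL vM vR vertexOfBits eps1 eps2 eps2' eps3 eps3' eps4 lab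
  decide

/-- **`𝔉 ε₁ = φ₁`**. [cite: AharonovJonesLandau2009, Claim 2.6] -/
theorem ajlF_mulVec_eps1 : ajlF *ᵥ basisState eps1 = vecC 1 := by
  obtain ⟨r1, -, -, -, -, -, -, -, -, -, -, -, -, -, -, c21, c31, -⟩ := readings
  rw [ajlF, ← Matrix.mulVec_mulVec, ajlRot3, ctrlGate_mulVec_basisState_of_one _ _ _ (by simp [rotBlock, c31]), ajlRot2,
    ctrlGate_mulVec_basisState_of_one _ _ _ (by simp [rotBlock, c21])]
  funext q
  rw [vecC, ajlLocalVec_eq]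
  by_cases hq : vL q = 1 ∧ vR q = 1 ∧ (vM q = 1 + 1 ∨ vM q = 1 - 1)
  · have hq1 : q = eps1 := (support_facts.1 q).1 hq
    rw [if_pos hq, hq1, r1, endAmp_eq_one.1]; simp [basisState]
  · have hq1 : q ≠ eps1 := fun e => hq ((support_facts.1 q).2 e)
    rw [if_neg hq]; simp [basisState, hq1]

/-- **`𝔉 ε₄ = φ₄`**. [cite: AharonovJonesLandau2009, Claim 2.6] -/
theorem ajlF_mulVec_eps4 : ajlF *ᵥ basisState eps4 = vecC 4 := by
  obtain ⟨-, -, -, -, -, r4, -, -, -, -, -, -, -, -, -, -, -, c24, c34, -⟩ := readings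
  rw [ajlF, ← Matrix.mulVec_mulVec, ajlRot3, ctrlGate_mulVec_basisState_of_one _ _ _ (by simp [rotBlock, c34]), ajlRot2,
    ctrlGate_mulVec_basisState_of_one _ _ _ (by simp [rotBlock, c24])]
  funext q
  rw [vecC, ajlLocalVec_eq]
  by_cases hq : vL q = 4 ∧ vR q = 4 ∧ (vM q = 4 + 1 ∨ vM q = 4 - 1)
  · have hq1 : q = eps4 := (support_facts.2.2.2.1 q).1 hq
    rw [if_pos hq, hq1, r4, endAmp_eq_one.2]; simp [basisState]
  · have hq1 : q ≠ eps4 := fun e => hq ((support_facts.2.2.2.1 q).2 e)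
    rw [if_neg hq]; simp [basisState, hq1]

/-- **`𝔉 ε₂ = φ₂`**. [cite: AharonovJonesLandau2009, Claim 2.6] -/
theorem ajlF_mulVec_eps2 : ajlF *ᵥ basisState eps2 = vecC 2 := by
  obtain ⟨-, r2, r2', -, -, -, e2', -, h22, -, c22, c32, -, -, -, -, -, -, -, n2, -⟩ := readings
  rw [ajlF, ← Matrix.mulVec_mulVec, ajlRot3, ctrlGate_mulVec_basisState_of_one _ _ _ (by simp [rotBlock, c32]), ajlRot2,
    ctrlGate_mulVec_basisState]
  simp only [rotBlock, if_pos c22, rot2x2_apply, h22, if_true, ← e2']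
  rw [show Function.update eps2 2 false = eps2 by rw [← h22, Function.update_eq_self]]
  funext q
  simp only [Pi.add_apply, Pi.smul_apply, basisState, Pi.single_apply, smul_eq_mul, mul_ite, mul_one, mul_zero]
  rw [vecC, ajlLocalVec_eq]
  by_cases hq : vL q = 2 ∧ vR q = 2 ∧ (vM q = 2 + 1 ∨ vM q = 2 - 1)
  · rw [if_pos hq]
    rcases (support_facts.2.1 q).1 hq with rfl | rfl
    · rw [if_pos rfl, if_neg n2, add_zero, r2, rotAmpA]; norm_num
    · rw [if_neg (Ne.symm n2), if_pos rfl, zero_add, r2', rotAmpB]; norm_num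
  · rw [if_neg hq]
    have hq1 : q ≠ eps2 := fun e => hq ((support_facts.2.1 q).2 (Or.inl e))
    have hq2 : q ≠ eps2' := fun e => hq ((support_facts.2.1 q).2 (Or.inr e))
    rw [if_neg hq1, if_neg hq2, add_zero, Complex.ofReal_zero]

/-- **`𝔉 ε₃ = φ₃`**. [cite: AharonovJonesLandau2009, Claim 2.6] -/
theorem ajlF_mulVec_eps3 : ajlF *ᵥ basisState eps3 = vecC 3 := by
  obtain ⟨-, -, -, r3, r3', -, -, e3', -, h32, -, -, c33, c23, c23', -, -, -, -, -, n3⟩ := readings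
  rw [ajlF, ← Matrix.mulVec_mulVec, ajlRot3, ctrlGate_mulVec_basisState]
  simp only [rotBlock, if_pos c33, rot2x2_apply, h32, if_true, ← e3']
  rw [show Function.update eps3 2 false = eps3 by rw [← h32, Function.update_eq_self], Matrix.mulVec_add, Matrix.mulVec_smul,
    Matrix.mulVec_smul, ajlRot2, ctrlGate_mulVec_basisState_of_one _ _ _ (by simp [rotBlock, c23]),
    ctrlGate_mulVec_basisState_of_one _ _ _ (by simp [rotBlock, c23'])]
  funext q
  simp only [Pi.add_apply, Pi.smul_apply, basisState, Pi.single_apply, smul_eq_mul, mul_ite, mul_one, mul_zero]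
  rw [vecC, ajlLocalVec_eq]
  by_cases hq : vL q = 3 ∧ vR q = 3 ∧ (vM q = 3 + 1 ∨ vM q = 3 - 1)
  · rw [if_pos hq]
    rcases (support_facts.2.2.1 q).1 hq with rfl | rfl
    · rw [if_pos rfl, if_neg n3, add_zero, r3, rotAmpA]; norm_num
    · rw [if_neg (Ne.symm n3), if_pos rfl, zero_add, r3', rotAmpB]; norm_num
  · rw [if_neg hq]
    have hq1 : q ≠ eps3 := fun e => hq ((support_facts.2.2.1 q).2 (Or.inl e))
    have hq2 : q ≠ eps3' := fun e => hq ((support_facts.2.2.1 q).2 (Or.inr e))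
    rw [if_neg hq1, if_neg hq2, add_zero, Complex.ofReal_zero]

/-! ### Assembly: `ajlLocalCore = 𝔉 D 𝔉ᴴ` -/

/-- The rank-one projection onto a basis state is the diagonal indicator. [folklore] -/
theorem projVec_basisState (l : QReg 6) : projVec (basisState l) = Matrix.diagonal (fun w => if w = l then (1 : ℂ) else 0) := by
  ext i j
  simp only [projVec, Matrix.vecMulVec_apply, basisState, Pi.single_apply, Pi.star_apply, Matrix.diagonal_apply]
  by_cases hi : i = l
  · subst hi
    by_cases hj : j = i
    · subst hj; simp
    · simp [hj, Ne.symm hj]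
  · simp [hi]

/-- **The controlled phase as `1 + (c − 1)·E`** with `E = Σ_z |ε_z⟩⟨ε_z|`. [folklore] -/
theorem ajlPhaseDiag_eq (c : ℂ) :
    ajlPhaseDiag c = 1 + (c - 1) • (projVec (basisState eps1) + projVec (basisState eps2) + projVec (basisState eps3) +
      projVec (basisState eps4)) := by
  have hfacts := support_facts.2.2.2.2
  have hd : eps1 ≠ eps2 ∧ eps1 ≠ eps3 ∧ eps1 ≠ eps4 ∧ eps2 ≠ eps3 ∧ eps2 ≠ eps4 ∧ eps3 ≠ eps4 := by
    unfold eps1 eps2 eps3 eps4 lab; decide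
  obtain ⟨d12, d13, d14, d23, d24, d34⟩ := hd
  ext i j
  rw [ajlPhaseDiag, projVec_basisState, projVec_basisState, projVec_basisState, projVec_basisState]
  simp only [Matrix.add_apply, Matrix.one_apply, Matrix.smul_apply, Matrix.diagonal_apply, smul_eq_mul]
  by_cases hij : i = j
  · subst hij
    simp only [if_true]
    by_cases hE : ECond i
    · rw [if_pos hE]
      rcases (hfacts i).1 hE with rfl | rfl | rfl | rfl
      · simp [d12, d13, d14]
      · simp [Ne.symm d12, d23, d24]
      · simp [Ne.symm d13, Ne.symm d23, d34]
      · simp [Ne.symm d14, Ne.symm d24, Ne.symm d34]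
    · rw [if_neg hE]
      have h1 : i ≠ eps1 := fun e => hE ((hfacts i).2 (Or.inl e))
      have h2 : i ≠ eps2 := fun e => hE ((hfacts i).2 (Or.inr (Or.inl e)))
      have h3 : i ≠ eps3 := fun e => hE ((hfacts i).2 (Or.inr (Or.inr (Or.inl e))))
      have h4 : i ≠ eps4 := fun e => hE ((hfacts i).2 (Or.inr (Or.inr (Or.inr e))))
      simp [h1, h2, h3, h4]
  · simp [hij]

/-- **`P = Σ_z |φ_z⟩⟨φ_z|` as rank-one projections.** [cite: AharonovJonesLandau2009, §2.12] -/
theorem ajlLocalProj_eq_sum_projVec :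
    ajlLocalProj = projVec (vecC 1) + projVec (vecC 2) + projVec (vecC 3) + projVec (vecC 4) := by
  ext q p
  simp only [ajlLocalProj, Matrix.of_apply, Matrix.add_apply, projVec, Matrix.vecMulVec_apply, vecC, Pi.star_apply,
    Complex.star_def, Complex.conj_ofReal, g5Vertices]
  rw [Finset.sum_insert (by decide), Finset.sum_insert (by decide), Finset.sum_insert (by decide), Finset.sum_singleton]
  push_cast; ring

/-- **The local core gate is two controlled rotations and a controlled phase, conjugated back:**
`ajlLocalCore ± = 𝔉 · D(c_±) · 𝔉ᴴ`. [cite: AharonovJonesLandau2009, Claim 4.1 (applying the local unitaries) and Claim 2.6] -/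
theorem ajlLocalCore_eq_conj (positive : Bool) :
    ajlLocalCore positive = ajlF * ajlPhaseDiag (ajlPhaseConst positive) * ajlFᴴ := by
  have hU : ajlF * ajlFᴴ = 1 := Matrix.mem_unitaryGroup_iff.1 ajlF_mem_unitaryGroup
  rw [ajlPhaseDiag_eq, Matrix.mul_add, Matrix.add_mul, Matrix.mul_one, hU, Matrix.mul_smul, Matrix.smul_mul,
    Matrix.mul_add, Matrix.mul_add, Matrix.mul_add, Matrix.add_mul, Matrix.add_mul, Matrix.add_mul,
    mul_projVec_mul_conjTranspose, mul_projVec_mul_conjTranspose, mul_projVec_mul_conjTranspose, mul_projVec_mul_conjTranspose,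
    ajlF_mulVec_eps1, ajlF_mulVec_eps2, ajlF_mulVec_eps3, ajlF_mulVec_eps4, ajlLocalCore, ajlLocalProj_eq_sum_projVec]

/-! ### The rotation entries are the golden-ratio values of `DyadicThresholds.lean` -/

/-- `d = 2cos(π/5) = φ`. [cite: AharonovJonesLandau2009, §2.12] -/
theorem ajlLoopValue_five_eq_goldenRatio : ajlLoopValue 5 = Real.goldenRatio := by
  rw [ajlLoopValue, Real.goldenRatio, show Real.pi / (5 : ℕ) = Real.pi / 5 by norm_num, Real.cos_pi_div_five]; ring

/-- `λ₂ = φ λ₁` (`dλ₁ = λ₀ + λ₂ = λ₂`) and `λ₃ = λ₂`, `λ₄ = λ₁` (symmetry of `sin`). [cite: AharonovJonesLandau2009, Claim 2.6] -/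
theorem ajlWeight_five_values :
    ajlWeight 5 2 = Real.goldenRatio * ajlWeight 5 1 ∧ ajlWeight 5 3 = ajlWeight 5 2 ∧ ajlWeight 5 4 = ajlWeight 5 1 := by
  have h1 := ajlWeight_pred_add_succ (k := 5) (z := 1) ⟨le_rfl, by norm_num⟩
  rw [ajlWeight_of_not (k := 5) (ℓ := 1 - 1) (by norm_num), zero_add, ajlLoopValue_five_eq_goldenRatio] at h1
  norm_num at h1
  refine ⟨h1, ?_, ?_⟩
  · rw [ajlWeight_of_mem (k := 5) (ℓ := 3) (by norm_num), ajlWeight_of_mem (k := 5) (ℓ := 2) (by norm_num)]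
    rw [show Real.pi * ((3 : ℤ) : ℝ) / (5 : ℕ) = Real.pi - Real.pi * ((2 : ℤ) : ℝ) / (5 : ℕ) by push_cast; ring, Real.sin_pi_sub]
  · rw [ajlWeight_of_mem (k := 5) (ℓ := 4) (by norm_num), ajlWeight_of_mem (k := 5) (ℓ := 1) (by norm_num)]
    rw [show Real.pi * ((4 : ℤ) : ℝ) / (5 : ℕ) = Real.pi - Real.pi * ((1 : ℤ) : ℝ) / (5 : ℕ) by push_cast; ring, Real.sin_pi_sub]

/-- **The entries of `G₂`, `G₃`**: `a₂ = b₃ = 1/φ` and `b₂ = a₃ = 1/√φ`. [cite: AharonovJonesLandau2009, Claim 2.6] -/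
theorem rotAmp_values :
    rotAmpA 2 = Real.goldenRatio⁻¹ ∧ rotAmpB 2 = 1 / Real.sqrt Real.goldenRatio ∧
      rotAmpA 3 = 1 / Real.sqrt Real.goldenRatio ∧ rotAmpB 3 = Real.goldenRatio⁻¹ := by
  obtain ⟨h2, h3, h4⟩ := ajlWeight_five_values
  have hφ := Real.goldenRatio_pos
  have hl1 : 0 < ajlWeight 5 1 := ajlWeight_pos (k := 5) (by norm_num)
  have hd := ajlLoopValue_five_eq_goldenRatio
  have hA : Real.sqrt (ajlWeight 5 1) / Real.sqrt (Real.goldenRatio * (Real.goldenRatio * ajlWeight 5 1)) = Real.goldenRatio⁻¹ := by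
    rw [show Real.goldenRatio * (Real.goldenRatio * ajlWeight 5 1) = Real.goldenRatio ^ 2 * ajlWeight 5 1 by ring,
      Real.sqrt_mul (by positivity), Real.sqrt_sq hφ.le, div_mul_eq_div_div, div_right_comm,
      div_self (Real.sqrt_pos.2 hl1).ne', one_div]
  have hB : Real.sqrt (Real.goldenRatio * ajlWeight 5 1) / Real.sqrt (Real.goldenRatio * (Real.goldenRatio * ajlWeight 5 1)) =
      1 / Real.sqrt Real.goldenRatio := by
    rw [Real.sqrt_mul hφ.le (Real.goldenRatio * ajlWeight 5 1), div_mul_eq_div_div_swap,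
      div_self (Real.sqrt_pos.2 (by positivity)).ne']
  refine ⟨?_, ?_, ?_, ?_⟩
  · rw [rotAmpA, hd, show (2 : ℤ) - 1 = 1 by norm_num, h2]; exact hA
  · rw [rotAmpB, hd, show (2 : ℤ) + 1 = 3 by norm_num, h3, h2]; exact hB
  · rw [rotAmpA, hd, show (3 : ℤ) - 1 = 2 by norm_num, h3, h2]; exact hB
  · rw [rotAmpB, hd, show (3 : ℤ) + 1 = 4 by norm_num, h4, h3, h2]; exact hA

end Literature.Computability.QuantumComplexity

end
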